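import Summits.AtomisticToContinuum.HydrodynamicLimit.Theorems.AntiMazurCoboundariesKineticWindowGronwallActivityInversion
import Summits.AtomisticToContinuum.HydrodynamicLimit.Theorems.PolynomialCompression.Negative.Everywhere
import HarnessLib

/-!
# Crux `SpeedCapSurgery.CappedEulerLimit` (stmt-AtomisticToContinuum-17739), line `registered`, stub `stub_reference`

IN-BAND STATICS OF THE REFERENCE FAMILY: `∃ ηs > 0, ReferenceStaticsBelow ηs` — below the packing threshold
`ηs := thresh r η₂` of `thermoActivity_spec` (insertion-factor package `insertionFactor_package`), for `σ ≤ 1/2`: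
(i) the initial local Gibbs laws are probability laws (`isProbabilityMeasure_localGibbsLaw`); (ii) along a
classical solution tied to them at `t = 0`, mass is conserved (`PolynomialCompressionEverywhere.integral_density_eq_one`,
`∫ρ_t = 1`), the slices are continuous and positive, so `thermoActivity_spec` / `thermoActivity_concentration`
give the probability + exponential concentration of the thermodynamic reference (`RefConcentrates`) at every `t ∈ [0,T)`.
The two `def`s are VERBATIM the registered skeleton's (`Cruxes/CappedEulerLimit/Lines/registered.lean`,
namespace `…Theorems.CappedEulerLimit`); worker file of the lead prover-line-stmt-AtomisticToContinuum-17739-0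
(`--supports stmt-AtomisticToContinuum-17739`).
-/

noncomputable section

namespace Summit.AtomisticToContinuum.HydrodynamicLimit.Theorems.CappedEulerLimit

open scoped ENNReal NNReal Topology
open MeasureTheory Filter Set
open Literature.Analysis.FluidPDE
open Literature.MathematicalPhysics.KineticTheory
open Summit.AtomisticToContinuum.HydrodynamicLimit.Theorems.KineticWindowGronwallActivityInversion

/-! ## §1 Statements (verbatim from the registered skeleton) -/

/-- **The reference concentrates.** For reduced diameter `σ`, a macroscopic triple `(r, θ', u')` on `𝕋³` and a
flow family `Φ`: the local Gibbs laws with the EOS activity `thermoActivity σ r`, velocity `u'` and temperature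
`θ'` are probability laws for every `N`, and their empirical density / momentum / energy fields tested against
any continuous `χ` concentrate exponentially (`≤ C e^{-(N+1)/C}`, all `N`) around `∫χ r`, `∫χ r u'`,
`∫χ E(r,u',θ')` (verbatim the sibling birth lines' `RefConcentrates`). [cite: OllaVaradhanYau1993, §3 Lemma 3.1–3.4] -/
def RefConcentrates (σ : ℝ) (r θ' : T3 → ℝ) (u' : T3 → V3)
    (Φ : (N : ℕ) → HardSphereFlow (Torus.geometry (Fin 3)) (hsDiameter σ N) (N + 1)) : Prop :=
  (∀ N, IsProbabilityMeasure (localGibbsLaw σ (thermoActivity σ r) u' θ' N (Φ N))) ∧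
  ∀ χ : T3 → ℝ, Continuous χ → ∀ δ : ℝ, 0 < δ → ∃ C : ℝ, 0 < C ∧ ∀ N : ℕ,
    localGibbsLaw σ (thermoActivity σ r) u' θ' N (Φ N)
        {z | δ < |empiricalDensityField z χ - ∫ x, χ x * r x|} ≤
      ENNReal.ofReal (C * Real.exp (-(C⁻¹ * (N + 1)))) ∧
    localGibbsLaw σ (thermoActivity σ r) u' θ' N (Φ N)
        {z | δ < ‖empiricalMomentumField z χ - ∫ x, (χ x * r x) • u' x‖} ≤
      ENNReal.ofReal (C * Real.exp (-(C⁻¹ * (N + 1)))) ∧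
    localGibbsLaw σ (thermoActivity σ r) u' θ' N (Φ N)
        {z | δ < |empiricalEnergyField z χ - ∫ x, χ x * totalEnergyDensity (r x) (u' x) (θ' x)|} ≤
      ENNReal.ofReal (C * Real.exp (-(C⁻¹ * (N + 1))))

/-- **In-band statics of the reference family below the packing threshold `ηs`**: for all continuous
positive profiles there is `σ₀ > 0` such that for `0 < σ < σ₀`, every classical hard-sphere Euler solution
`(ρ, u, θ)` on `[0,T)` with `ρ_t σ³ < ηs` on `[0,T) × 𝕋³` and every flow family `Φ`: (i) the initial local
Gibbs laws are probability laws; (ii) if their empirical fields converge at `t = 0` to `(ρ, ρu, E)(0)` then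
at every `t ∈ [0,T)` the EOS reference `(thermoActivity σ (ρ t), u t, θ t)` concentrates around `(ρ, ρu, E)(t)`
(`RefConcentrates`; mass conservation gives `∫ρ_t = 1`, the normalisation the dilute statics need).
[cite: Yau1991, §2] [cite: Ruelle1969, §3.4 and §4.2 Thm 4.2.3] -/
def ReferenceStaticsBelow (ηs : ℝ) : Prop :=
  ∀ (a₀ θ₀ : T3 → ℝ) (u₀ : T3 → V3), Continuous a₀ → Continuous θ₀ → Continuous u₀ →
    (∀ x, 0 < a₀ x) → (∀ x, 0 < θ₀ x) →
    ∃ σ₀ : ℝ, 0 < σ₀ ∧ ∀ σ : ℝ, 0 < σ → σ < σ₀ →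
      ∀ (T : ℝ) (ρ θ : ℝ → T3 → ℝ) (u : ℝ → T3 → V3), IsHardSphereEulerSolution σ T ρ u θ →
        (∀ t ∈ Ico 0 T, ∀ x, ρ t x * σ ^ 3 < ηs) →
        ∀ Φ : (N : ℕ) → HardSphereFlow (Torus.geometry (Fin 3)) (hsDiameter σ N) (N + 1),
          (∀ N, IsProbabilityMeasure (localGibbsLaw σ a₀ u₀ θ₀ N (Φ N))) ∧
          (TendstoHydroFieldsAt (fun N => localGibbsLaw σ a₀ u₀ θ₀ N (Φ N)) Φ ρ u θ 0 →
            ∀ t ∈ Ico 0 T, RefConcentrates σ (ρ t) (θ t) (u t) Φ)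

/-! ## §2 The stub -/

/-- **Stub `stub_reference` — IN-BAND STATICS OF THE REFERENCE FAMILY.** There is a packing threshold `ηs > 0`
with `ReferenceStaticsBelow ηs` (`ηs := thresh r η₂` of the insertion-factor package; `σ₀ := 1/2`).
[cite: Ruelle1969, §3.4 and §4.2 Thm 4.2.3] [cite: Yau1991, §2] -/
theorem stub_reference : ∃ ηs : ℝ, 0 < ηs ∧ ReferenceStaticsBelow ηs := by
  obtain ⟨r, hr, Rf, hsol, hbd, hcont, huniq, η₂, hη₂, -, hexp⟩ := insertionFactor_package
  refine ⟨thresh r η₂, thresh_pos hr hη₂, ?_⟩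
  intro a₀ θ₀ u₀ ha hθ hu ha0 hθ0
  refine ⟨1 / 2, by norm_num, fun σ hσ hσlt T ρ θ u hE hguard Φ => ?_⟩
  have hσ2 : σ ≤ 1 / 2 := hσlt.le
  refine ⟨fun N => isProbabilityMeasure_localGibbsLaw ha hθ hu ha0 hθ0 hσ2 N (Φ N), fun hA t ht => ?_⟩
  -- the slices at time `t ∈ [0, T)`: continuous, positive, of unit mass, below the packing threshold
  have hρc : Continuous (ρ t) := (hE.smooth_density.isSmooth_slice ht).continuous
  have hutc : Continuous (u t) := (hE.smooth_velocity.isSmooth_slice ht).continuous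
  have hθtc : Continuous (θ t) := (hE.smooth_temperature.isSmooth_slice ht).continuous
  have hρ0 : ∀ x, 0 < ρ t x := hE.density_pos t ht
  have hθt0 : ∀ x, 0 < θ t x := hE.temperature_pos t ht
  have hρ1 : ∫ x, ρ t x = 1 :=
    PolynomialCompressionEverywhere.integral_density_eq_one hσ2 ha hθ hu ha0 hθ0 hE Φ hA ht
  have hpack : ∀ x, ρ t x * σ ^ 3 ≤ thresh r η₂ := fun x => (hguard t ht x).le
  -- the thermodynamic activity is continuous and positive (statics regime), hence probability laws …
  obtain ⟨hσ2', -, ha', ha0', -⟩ :=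
    thermoActivity_spec hr hsol hbd hcont huniq hη₂ hexp hσ hρc hρ0 hρ1 hpack
  refine ⟨fun N => isProbabilityMeasure_localGibbsLaw ha' hθtc hutc ha0' hθt0 hσ2'.le N (Φ N),
    fun χ hχ δ hδ => ?_⟩
  -- … whose empirical fields concentrate exponentially around `(ρ, ρu, E)(t)` (all `N`, all flows)
  obtain ⟨C, hC, hCb⟩ :=
    thermoActivity_concentration hr hsol hbd hcont huniq hη₂ hexp hσ hρc hρ0 hρ1 hpack hθtc hutc hθt0 hχ hδ
  exact ⟨C, hC, fun N => hCb N (Φ N)⟩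

end Summit.AtomisticToContinuum.HydrodynamicLimit.Theorems.CappedEulerLimit

end
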